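import Summits.NavierStokesRegularity.NavierStokesRegularity.Theorems.TypeICertificateLadderRungReynoldsOneLerayRate
import Summits.NavierStokesRegularity.NavierStokesRegularity.Theorems.TypeICertificateLadderStrainRateThresholdOne
import Summits.NavierStokesRegularity.NavierStokesRegularity.Theorems.TypeICertificateLadderStretchingRateThresholdOne
import HarnessLib

/-!
# Route TypeICertificateLadder — the three explicit thresholds `1` at a singular time, packaged
  (C31-F / C32 / C35 of cell pub-ns-dss; helper of crux stmt-NavierStokesRegularity-2882)

For the hypothetical object of the blow-up conjunct `X5a` — a maximal smooth solution with lifespan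
`T > 0` of the unforced Navier–Stokes system (`IsMaximalSmoothSolution`), Leray–Hopf on `[0, T]` from
its rapidly decaying datum — the kernel holds three rate statements with the explicit constant `1`,
proved by three different mechanisms:

* Leray rate (C31-F; the landed rung `X_1`, `typeICertificateLadder_rungReynoldsOne`: L^{5/2}
  vorticity budget against Tao's `H¹` lifespan): `√ν < √(T − t)‖u(t,x)‖` somewhere, frequently;
* strain rate (C32, `strainRate_frequently_gt_of_not_hasSobolevExtensionPast`: Kato + weight + whole-
  space maximum principle + Beale–Kato–Majda): `θ‖ξ‖² < (T − t)⟪∇u ξ, ξ⟫` somewhere, `θ < 1`;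
* directional stretching rate (C35, `directionalStretching_frequently_gt_of_not_hasSobolevExtensionPast`:
  Kato with the trivial Constantin certificate): `θ < (T − t)(⟪∇u ξ, ξ⟫ − |∇ξ|²_F)` at a point of
  the vortex set, `θ < 1` (`ν = 1`).

* `typeICertificateLadder_singularTimeThresholds` — the conjunction at `ν = 1`, `∃ᶠ` forms;
* `one_le_limsup_strainRate_of_not_hasSobolevExtensionPast`,
  `one_le_limsup_directionalStretching_of_not_hasSobolevExtensionPast` — C32 and C35 as the ladder's
  `limsup ≥ 1` sentences (suprema in `ℝ≥0∞`; cf. `one_le_limsup_lerayRate_of_isMaximalSmoothSolution`).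

HONEST FRAMING: statements about a HYPOTHETICAL singular time; the three `1`'s are thresholds of
perturbative / elementary arguments, nothing is said at or above them; nothing here bears on the
regularity question itself. Lands `--supports stmt-NavierStokesRegularity-2882`.
-/

noncomputable section

namespace Summit.NavierStokesRegularity.NavierStokesRegularity.Theorems

set_option linter.dupNamespace false

open MeasureTheory Set Filter Topology Function
open scoped RealInnerProductSpace ENNReal
open Literature.Analysis Literature.Analysis.FluidPDE

/-- **C32, `limsup` form: `1 ≤ limsup_{t↑T} sup_{x, ξ ≠ 0} (T − t)⟪∇u(t,x) ξ, ξ⟫/‖ξ‖²`** for a classical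
Navier–Stokes solution (`ν > 0`) on `ℝ³ × [0,T)` in the BKM class that cannot be continued in the
class past `T` (the supremum in `ℝ≥0∞`; `ξ = 0` contributes `0`). [this file] -/
theorem one_le_limsup_strainRate_of_not_hasSobolevExtensionPast {ν T : ℝ} (hν : 0 < ν) (hT : 0 < T)
    {u : ℝ → EuclideanSpace ℝ (Fin 3) → EuclideanSpace ℝ (Fin 3)}
    {p : ℝ → EuclideanSpace ℝ (Fin 3) → ℝ}
    (hsol : IsClassicalNSSolutionOn (Ico 0 T) ν 0 u p)
    (hreg : ∀ T'' < T, HasBoundedSobolevNormsOn (Icc 0 T'') u)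
    (hmax : ¬ HasSobolevExtensionPast ν u T) :
    1 ≤ Filter.limsup (fun t => ⨆ x : EuclideanSpace ℝ (Fin 3), ⨆ ξ : EuclideanSpace ℝ (Fin 3),
      ENNReal.ofReal ((T - t) * ⟪fderiv ℝ (u t) x ξ, ξ⟫ / ‖ξ‖ ^ 2)) (𝓝[<] T) := by
  refine le_of_forall_lt_imp_le_of_dense fun a ha => ?_
  have ha' : a ≠ ⊤ := ne_top_of_lt ha
  have hθ : a.toReal < 1 := by
    have := (ENNReal.toReal_lt_toReal ha' ENNReal.one_ne_top).2 ha
    simpa using this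
  have hfr := strainRate_frequently_gt_of_not_hasSobolevExtensionPast hν hT hsol hreg hmax hθ
  refine Filter.le_limsup_of_frequently_le (hfr.mono ?_)
  rintro t ⟨x, ξ, hx⟩
  -- `ξ ≠ 0` since `θ‖ξ‖² < (T − t)⟪∇u ξ, ξ⟫` fails for `ξ = 0`
  have hξ : 0 < ‖ξ‖ ^ 2 := by
    rcases (sq_nonneg ‖ξ‖).eq_or_lt with h0 | h0
    · exfalso
      have hz : ξ = 0 := by
        have : ‖ξ‖ = 0 := by nlinarith [norm_nonneg ξ]
        exact norm_eq_zero.1 this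
      rw [hz] at hx
      simp at hx
    · exact h0
  refine le_iSup_of_le x (le_iSup_of_le ξ ?_)
  rw [← ENNReal.ofReal_toReal ha']
  refine ENNReal.ofReal_le_ofReal ?_
  rw [le_div_iff₀ hξ]
  exact hx.le

/-- **C35, `limsup` form: `1 ≤ limsup_{t↑T} sup_x (T − t)(⟪∇u(t,x) ξ, ξ⟫ − |∇ξ(t,x)|²_F)`**, `ξ` the
vorticity direction, for a classical Navier–Stokes solution (`ν = 1`) on `ℝ³ × [0,T)` in the BKM class
that cannot be continued in the class past `T` (the supremum in `ℝ≥0∞`; the points with `ω ≠ 0`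
already give the bound). [this file] -/
theorem one_le_limsup_directionalStretching_of_not_hasSobolevExtensionPast {T : ℝ} (hT : 0 < T)
    {u : ℝ → EuclideanSpace ℝ (Fin 3) → EuclideanSpace ℝ (Fin 3)}
    {p : ℝ → EuclideanSpace ℝ (Fin 3) → ℝ}
    (hsol : IsClassicalNSSolutionOn (Ico 0 T) 1 0 u p)
    (hreg : ∀ T'' < T, HasBoundedSobolevNormsOn (Icc 0 T'') u)
    (hmax : ¬ HasSobolevExtensionPast 1 u T) :
    1 ≤ Filter.limsup (fun t => ⨆ x : EuclideanSpace ℝ (Fin 3),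
      ENNReal.ofReal ((T - t) * (⟪fderiv ℝ (u t) x (vorticityDirection (curl (u t)) x),
          vorticityDirection (curl (u t)) x⟫
        - frobeniusNormSq (fderiv ℝ (vorticityDirection (curl (u t))) x)))) (𝓝[<] T) := by
  refine le_of_forall_lt_imp_le_of_dense fun a ha => ?_
  have ha' : a ≠ ⊤ := ne_top_of_lt ha
  have hθ : a.toReal < 1 := by
    have := (ENNReal.toReal_lt_toReal ha' ENNReal.one_ne_top).2 ha
    simpa using this
  have hfr := directionalStretching_frequently_gt_of_not_hasSobolevExtensionPast hT hsol hreg hmax hθ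
  refine Filter.le_limsup_of_frequently_le (hfr.mono ?_)
  rintro t ⟨x, -, hx⟩
  refine le_iSup_of_le x ?_
  rw [← ENNReal.ofReal_toReal ha']
  exact ENNReal.ofReal_le_ofReal hx.le

/-- **The three explicit thresholds at a singular time (`ν = 1`).** For a maximal smooth solution
`(u, p)` with lifespan `T > 0` of unforced Navier–Stokes (`ν = 1`) on `ℝ³`, Leray–Hopf on `[0,T]` from
its rapidly decaying datum, and every `θ < 1`: frequently as `t ↑ T`,
(i) `1 < √(T − t)‖u(t,x)‖` for some `x` (C31-F, the rung `X_1`);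
(ii) `θ‖ξ‖² < (T − t)⟪∇u(t,x) ξ, ξ⟫` for some `x, ξ` (C32);
(iii) `θ < (T − t)(⟪∇u(t,x) ξ, ξ⟫ − |∇ξ(t,x)|²_F)` for some `x` with `ω(t,x) ≠ 0`, `ξ = ω/|ω|` (C35).
[this file] -/
theorem typeICertificateLadder_singularTimeThresholds {T : ℝ} (hT : 0 < T)
    {u : ℝ → EuclideanSpace ℝ (Fin 3) → EuclideanSpace ℝ (Fin 3)}
    {p : ℝ → EuclideanSpace ℝ (Fin 3) → ℝ}
    (hmax : IsMaximalSmoothSolution 1 0 u p T) (hLH : IsLerayHopfOn T 1 0 (u 0) u)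
    (hdec : HasRapidSpatialDecay (u 0)) {θ : ℝ} (hθ : θ < 1) :
    (∃ᶠ t in 𝓝[<] T, ∃ x, 1 < Real.sqrt (T - t) * ‖u t x‖) ∧
    (∃ᶠ t in 𝓝[<] T, ∃ x ξ : EuclideanSpace ℝ (Fin 3),
      θ * ‖ξ‖ ^ 2 < (T - t) * ⟪fderiv ℝ (u t) x ξ, ξ⟫) ∧
    (∃ᶠ t in 𝓝[<] T, ∃ x, curl (u t) x ≠ 0 ∧
      θ < (T - t) * (⟪fderiv ℝ (u t) x (vorticityDirection (curl (u t)) x),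
          vorticityDirection (curl (u t)) x⟫
        - frobeniusNormSq (fderiv ℝ (vorticityDirection (curl (u t))) x))) := by
  refine ⟨?_, typeICertificateLadder_strainRate_frequently_gt one_pos hT hmax.1 hLH hdec hmax.2 hθ,
    typeICertificateLadder_directionalStretching_frequently_gt hT hmax.1 hLH hdec hmax.2 hθ⟩
  have h := lerayRate_frequently_gt_of_isMaximalSmoothSolution 1 T one_pos hT u p hmax hLH hdec
  simpa only [Real.sqrt_one] using h

end Summit.NavierStokesRegularity.NavierStokesRegularity.Theorems

end
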